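import Mathlib.Analysis.SpecialFunctions.Trigonometric.ArctanDeriv
import Mathlib.LinearAlgebra.Matrix.SpecialLinearGroup
import HarnessLib

/-!
# Rotation = three shears (Paeth factorisation) in `SL(2, ℝ)`

For `cos (θ/2) ≠ 0` the plane rotation factors as
`R(θ) = L(tan(θ/2)) · U(−sin θ) · L(tan(θ/2))`, with `U(x) = !![1, x; 0, 1]`, `L(x) = !![1, 0; x, 1]`,
and `L(x) = w · U(−x) · w⁻¹` for the Weyl element `w = R(π/2) = !![0, −1; 1, 0]`; equivalently
`R(θ) = w U(−t) w⁻¹ · U(s) · w U(−t) w⁻¹` with `t = tan(θ/2)`, `s = −sin θ` (`t(0) = s(0) = 0`,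
`t'(0) = 1/2`, `s'(0) = −1`).  We record the identity for `2 × 2` real matrices, in the group
`Matrix.SpecialLinearGroup (Fin 2) ℝ`, its image under any monoid homomorphism `SL(2,ℝ) →* G` (the form a
consumer with an `SL₂`-triple inside a larger group uses), and the derivative data at `θ = 0`.
Elementary (three-shear raster rotation, A. Paeth 1986); kernel only. [folklore]
-/

noncomputable section

open Real Filter Topology

namespace Literature.LinearAlgebra.Matrix.RotationThreeShears

/-- the upper shear `U(x) = !![1, x; 0, 1]`. [folklore] -/
def upperShear (x : ℝ) : Matrix (Fin 2) (Fin 2) ℝ := !![1, x; 0, 1]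

/-- the lower shear `L(x) = !![1, 0; x, 1]`. [folklore] -/
def lowerShear (x : ℝ) : Matrix (Fin 2) (Fin 2) ℝ := !![1, 0; x, 1]

/-- the rotation `R(θ) = !![cos θ, −sin θ; sin θ, cos θ]`. [folklore] -/
def rot (θ : ℝ) : Matrix (Fin 2) (Fin 2) ℝ := !![cos θ, -sin θ; sin θ, cos θ]

/-- the Weyl element `w = R(π/2) = !![0, −1; 1, 0]`. [folklore] -/
def weyl : Matrix (Fin 2) (Fin 2) ℝ := !![0, -1; 1, 0]

/-- `w = R(π/2)`. [folklore] -/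
theorem weyl_eq_rot : weyl = rot (π / 2) := by
  simp [weyl, rot]

/-! ## Half-angle identities -/

/-- `1 − tan φ · sin 2φ = cos 2φ` (`cos φ ≠ 0`). [folklore] -/
theorem one_sub_tan_mul_sin_two_mul {φ : ℝ} (h : cos φ ≠ 0) : 1 - tan φ * sin (2 * φ) = cos (2 * φ) := by
  have h1 : tan φ * sin (2 * φ) = 2 * sin φ ^ 2 := by
    rw [tan_eq_sin_div_cos, sin_two_mul, div_mul_eq_mul_div, ← mul_assoc, mul_div_cancel_right₀ _ h]
    ring
  rw [h1, cos_two_mul]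
  linear_combination (-2) * sin_sq_add_cos_sq φ

/-- `tan φ · (1 + cos 2φ) = sin 2φ` (`cos φ ≠ 0`). [folklore] -/
theorem tan_mul_one_add_cos_two_mul {φ : ℝ} (h : cos φ ≠ 0) : tan φ * (1 + cos (2 * φ)) = sin (2 * φ) := by
  rw [tan_eq_sin_div_cos, sin_two_mul, cos_two_mul,
    show (1 : ℝ) + (2 * cos φ ^ 2 - 1) = (2 * cos φ) * cos φ by ring, div_mul_eq_mul_div, ← mul_assoc,
    mul_div_cancel_right₀ _ h]
  ring

/-- `1 − tan(θ/2) · sin θ = cos θ` (`cos (θ/2) ≠ 0`). [folklore] -/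
theorem one_sub_tan_half_mul_sin {θ : ℝ} (h : cos (θ / 2) ≠ 0) : 1 - tan (θ / 2) * sin θ = cos θ := by
  have := one_sub_tan_mul_sin_two_mul h
  rwa [show 2 * (θ / 2) = θ by ring] at this

/-- `tan(θ/2) · (1 + cos θ) = sin θ` (`cos (θ/2) ≠ 0`). [folklore] -/
theorem tan_half_mul_one_add_cos {θ : ℝ} (h : cos (θ / 2) ≠ 0) : tan (θ / 2) * (1 + cos θ) = sin θ := by
  have := tan_mul_one_add_cos_two_mul h
  rwa [show 2 * (θ / 2) = θ by ring] at this

/-! ## The factorisation for matrices -/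

/-- `w · U(−x) = L(x) · w`. [folklore] -/
theorem weyl_mul_upperShear_neg (x : ℝ) : weyl * upperShear (-x) = lowerShear x * weyl := by
  ext i j
  fin_cases i <;> fin_cases j <;> simp [weyl, upperShear, lowerShear, Matrix.mul_apply, Fin.sum_univ_two]

/-- **Paeth's three-shear factorisation** `R(θ) = L(tan(θ/2)) · U(−sin θ) · L(tan(θ/2))` for
`cos (θ/2) ≠ 0`. [folklore] -/
theorem rot_eq_lower_upper_lower {θ : ℝ} (h : cos (θ / 2) ≠ 0) :
    rot θ = lowerShear (tan (θ / 2)) * upperShear (-sin θ) * lowerShear (tan (θ / 2)) := by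
  have h1 := one_sub_tan_half_mul_sin h
  have h2 := tan_half_mul_one_add_cos h
  ext i j
  fin_cases i <;> fin_cases j <;>
    simp [rot, upperShear, lowerShear, Matrix.mul_apply, Fin.sum_univ_two]
  · linear_combination -h1
  · linear_combination -(tan (θ / 2)) * h1 - h2
  · linear_combination -h1

/-- the mirror form `R(θ) = U(−tan(θ/2)) · L(sin θ) · U(−tan(θ/2))`. [folklore] -/
theorem rot_eq_upper_lower_upper {θ : ℝ} (h : cos (θ / 2) ≠ 0) :
    rot θ = upperShear (-tan (θ / 2)) * lowerShear (sin θ) * upperShear (-tan (θ / 2)) := by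
  have h1 := one_sub_tan_half_mul_sin h
  have h2 := tan_half_mul_one_add_cos h
  ext i j
  fin_cases i <;> fin_cases j <;>
    simp [rot, upperShear, lowerShear, Matrix.mul_apply, Fin.sum_univ_two]
  · linear_combination -h1
  · linear_combination (tan (θ / 2)) * h1 + h2
  · linear_combination -h1

/-! ## In `SL(2, ℝ)` and under homomorphisms -/

/-- `U(x)` as an element of `SL(2,ℝ)`. [folklore] -/
def slUpper (x : ℝ) : Matrix.SpecialLinearGroup (Fin 2) ℝ :=
  ⟨upperShear x, by simp [upperShear, Matrix.det_fin_two_of]⟩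

/-- `L(x)` as an element of `SL(2,ℝ)`. [folklore] -/
def slLower (x : ℝ) : Matrix.SpecialLinearGroup (Fin 2) ℝ :=
  ⟨lowerShear x, by simp [lowerShear, Matrix.det_fin_two_of]⟩

/-- `R(θ)` as an element of `SL(2,ℝ)`. [folklore] -/
def slRot (θ : ℝ) : Matrix.SpecialLinearGroup (Fin 2) ℝ :=
  ⟨rot θ, by
    rw [rot, Matrix.det_fin_two_of]
    nlinarith [sin_sq_add_cos_sq θ]⟩

/-- the Weyl element as an element of `SL(2,ℝ)`. [folklore] -/
def slWeyl : Matrix.SpecialLinearGroup (Fin 2) ℝ :=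
  ⟨weyl, by simp [weyl, Matrix.det_fin_two_of]⟩

/-- coercions. [folklore] -/
@[simp] theorem coe_slUpper (x : ℝ) : ((slUpper x : Matrix.SpecialLinearGroup (Fin 2) ℝ) :
    Matrix (Fin 2) (Fin 2) ℝ) = upperShear x := rfl

/-- coercions. [folklore] -/
@[simp] theorem coe_slLower (x : ℝ) : ((slLower x : Matrix.SpecialLinearGroup (Fin 2) ℝ) :
    Matrix (Fin 2) (Fin 2) ℝ) = lowerShear x := rfl

/-- coercions. [folklore] -/
@[simp] theorem coe_slRot (θ : ℝ) : ((slRot θ : Matrix.SpecialLinearGroup (Fin 2) ℝ) :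
    Matrix (Fin 2) (Fin 2) ℝ) = rot θ := rfl

/-- coercions. [folklore] -/
@[simp] theorem coe_slWeyl : ((slWeyl : Matrix.SpecialLinearGroup (Fin 2) ℝ) :
    Matrix (Fin 2) (Fin 2) ℝ) = weyl := rfl

/-- `U` is a one-parameter group: `U(x + y) = U(x) · U(y)`. [folklore] -/
theorem slUpper_add (x y : ℝ) : slUpper (x + y) = slUpper x * slUpper y := by
  ext i j
  simp only [coe_slUpper, Matrix.SpecialLinearGroup.coe_mul]
  fin_cases i <;> fin_cases j <;> simp [upperShear, Matrix.mul_apply, Fin.sum_univ_two]; ring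

/-- `U(0) = 1`. [folklore] -/
@[simp] theorem slUpper_zero : slUpper 0 = 1 := by
  ext i j
  simp only [coe_slUpper, Matrix.SpecialLinearGroup.coe_one]
  fin_cases i <;> fin_cases j <;> simp [upperShear]

/-- `R(0) = 1`. [folklore] -/
@[simp] theorem slRot_zero : slRot 0 = 1 := by
  ext i j
  simp only [coe_slRot, Matrix.SpecialLinearGroup.coe_one]
  fin_cases i <;> fin_cases j <;> simp [rot]

/-- the split torus element `D(a) = diag(a, a⁻¹)` of `SL(2,ℝ)` (`a ≠ 0`). [folklore] -/
def slDiag (a : ℝ) (ha : a ≠ 0) : Matrix.SpecialLinearGroup (Fin 2) ℝ :=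
  ⟨!![a, 0; 0, a⁻¹], by simp [Matrix.det_fin_two_of, mul_inv_cancel₀ ha]⟩

/-- coercions. [folklore] -/
@[simp] theorem coe_slDiag (a : ℝ) (ha : a ≠ 0) : ((slDiag a ha : Matrix.SpecialLinearGroup (Fin 2) ℝ) :
    Matrix (Fin 2) (Fin 2) ℝ) = !![a, 0; 0, a⁻¹] := rfl

/-- `D(a) · U(y) = U(a² y) · D(a)`. [folklore] -/
theorem slDiag_mul_slUpper (a : ℝ) (ha : a ≠ 0) (y : ℝ) :
    slDiag a ha * slUpper y = slUpper (a ^ 2 * y) * slDiag a ha := by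
  ext i j
  simp only [Matrix.SpecialLinearGroup.coe_mul, coe_slDiag, coe_slUpper]
  fin_cases i <;> fin_cases j <;> simp [upperShear, Matrix.mul_apply, Fin.sum_univ_two]
  field_simp

/-- the dilation relation `D(a) · U(y) · D(a)⁻¹ = U(a² y)` (the `hconj` input of the unipotent pin, e.g.
`a = 2`: `D(2) U(y) D(2)⁻¹ = U(4y)`). [folklore] -/
theorem slDiag_conj_slUpper (a : ℝ) (ha : a ≠ 0) (y : ℝ) :
    slDiag a ha * slUpper y * (slDiag a ha)⁻¹ = slUpper (a ^ 2 * y) := by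
  rw [mul_inv_eq_iff_eq_mul, slDiag_mul_slUpper]

/-- `w · U(−x) · w⁻¹ = L(x)` in `SL(2,ℝ)`. [folklore] -/
theorem slWeyl_conj_slUpper_neg (x : ℝ) : slWeyl * slUpper (-x) * slWeyl⁻¹ = slLower x := by
  rw [mul_inv_eq_iff_eq_mul]
  ext i j
  simp only [Matrix.SpecialLinearGroup.coe_mul, coe_slWeyl, coe_slUpper, coe_slLower]
  rw [weyl_mul_upperShear_neg]

/-- **The rotation as a `w`-conjugate triple word**:
`R(θ) = w U(−t) w⁻¹ · U(s) · w U(−t) w⁻¹`, `t = tan(θ/2)`, `s = −sin θ`. [folklore] -/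
theorem slRot_eq_word {θ : ℝ} (h : cos (θ / 2) ≠ 0) :
    slRot θ = slWeyl * slUpper (-tan (θ / 2)) * slWeyl⁻¹ * slUpper (-sin θ) *
      (slWeyl * slUpper (-tan (θ / 2)) * slWeyl⁻¹) := by
  rw [slWeyl_conj_slUpper_neg]
  ext i j
  simp only [Matrix.SpecialLinearGroup.coe_mul, coe_slRot, coe_slUpper, coe_slLower]
  rw [rot_eq_lower_upper_lower h]

/-- the word identity transported along any homomorphism `φ : SL(2,ℝ) →* G`: with `u = φ ∘ U`, `w' = φ w`,
`φ (R θ) = w' u(−t) w'⁻¹ · u(s) · w' u(−t) w'⁻¹`. [folklore] -/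
theorem map_slRot_eq_word {G : Type*} [Group G] (φ : Matrix.SpecialLinearGroup (Fin 2) ℝ →* G) {θ : ℝ}
    (h : cos (θ / 2) ≠ 0) :
    φ (slRot θ) = φ slWeyl * φ (slUpper (-tan (θ / 2))) * (φ slWeyl)⁻¹ * φ (slUpper (-sin θ)) *
      (φ slWeyl * φ (slUpper (-tan (θ / 2))) * (φ slWeyl)⁻¹) := by
  rw [slRot_eq_word h]
  simp only [map_mul, map_inv]

/-- `cos (θ/2) ≠ 0` near `θ = 0`. [folklore] -/
theorem eventually_cos_half_ne_zero : ∀ᶠ θ in 𝓝 (0 : ℝ), cos (θ / 2) ≠ 0 :=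
  ((continuous_cos.comp (continuous_id.div_const 2)).continuousAt).eventually_ne (by simp)

/-- eventual version: the word identity holds for all `θ` near `0`. [folklore] -/
theorem eventually_map_slRot_eq_word {G : Type*} [Group G] (φ : Matrix.SpecialLinearGroup (Fin 2) ℝ →* G) :
    ∀ᶠ θ in 𝓝 (0 : ℝ), φ (slRot θ) = φ slWeyl * φ (slUpper (-tan (θ / 2))) * (φ slWeyl)⁻¹ *
      φ (slUpper (-sin θ)) * (φ slWeyl * φ (slUpper (-tan (θ / 2))) * (φ slWeyl)⁻¹) := by
  filter_upwards [eventually_cos_half_ne_zero] with θ h using map_slRot_eq_word φ h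

/-! ### Mirror form: lower shears as the one-parameter group

When the LOWER shears are the distinguished unipotents (`u = φ ∘ L`), the same rotation is the word
`R(θ) = w' L(−t) w'⁻¹ · L(s) · w' L(−t) w'⁻¹` with `w' = w⁻¹`, `t = −tan(θ/2)`, `s = sin θ` (`s' − 2t' = 2`). -/

/-- `w⁻¹ · L(x) · (w⁻¹)⁻¹ = U(−x)` in `SL(2,ℝ)`. [folklore] -/
theorem slWeyl_inv_conj_slLower (x : ℝ) : slWeyl⁻¹ * slLower x * slWeyl⁻¹⁻¹ = slUpper (-x) := by
  rw [inv_inv, ← slWeyl_conj_slUpper_neg x]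
  group

/-- the rotation as a `w⁻¹`-conjugate triple word in LOWER shears:
`R(θ) = w⁻¹ L(tan θ/2) w · L(sin θ) · w⁻¹ L(tan θ/2) w`. [folklore] -/
theorem slRot_eq_word' {θ : ℝ} (h : cos (θ / 2) ≠ 0) :
    slRot θ = slWeyl⁻¹ * slLower (tan (θ / 2)) * slWeyl⁻¹⁻¹ * slLower (sin θ) *
      (slWeyl⁻¹ * slLower (tan (θ / 2)) * slWeyl⁻¹⁻¹) := by
  rw [slWeyl_inv_conj_slLower]
  ext i j
  simp only [Matrix.SpecialLinearGroup.coe_mul, coe_slRot, coe_slUpper, coe_slLower]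
  rw [rot_eq_upper_lower_upper h]

/-- the mirror word identity transported along `φ : SL(2,ℝ) →* G`. [folklore] -/
theorem map_slRot_eq_word' {G : Type*} [Group G] (φ : Matrix.SpecialLinearGroup (Fin 2) ℝ →* G) {θ : ℝ}
    (h : cos (θ / 2) ≠ 0) :
    φ (slRot θ) = φ slWeyl⁻¹ * φ (slLower (tan (θ / 2))) * (φ slWeyl⁻¹)⁻¹ * φ (slLower (sin θ)) *
      (φ slWeyl⁻¹ * φ (slLower (tan (θ / 2))) * (φ slWeyl⁻¹)⁻¹) := by
  rw [slRot_eq_word' h]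
  simp only [map_mul, map_inv]

/-- eventual mirror version near `θ = 0`. [folklore] -/
theorem eventually_map_slRot_eq_word' {G : Type*} [Group G] (φ : Matrix.SpecialLinearGroup (Fin 2) ℝ →* G) :
    ∀ᶠ θ in 𝓝 (0 : ℝ), φ (slRot θ) = φ slWeyl⁻¹ * φ (slLower (tan (θ / 2))) * (φ slWeyl⁻¹)⁻¹ *
      φ (slLower (sin θ)) * (φ slWeyl⁻¹ * φ (slLower (tan (θ / 2))) * (φ slWeyl⁻¹)⁻¹) := by
  filter_upwards [eventually_cos_half_ne_zero] with θ h using map_slRot_eq_word' φ h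

/-! ## Derivative data at `θ = 0` -/

/-- `t = tan(·/2)`: `t(0) = 0`. [folklore] -/
theorem tan_half_zero : tan ((0 : ℝ) / 2) = 0 := by simp

/-- `s = −sin`: `s(0) = 0`. [folklore] -/
theorem neg_sin_zero : -sin (0 : ℝ) = 0 := by simp

/-- `t'(0) = 1/2`. [folklore] -/
theorem hasDerivAt_tan_half_zero : HasDerivAt (fun θ : ℝ => tan (θ / 2)) (1 / 2) 0 := by
  have h0 : cos ((0 : ℝ) / 2) ≠ 0 := by simp
  have h := (hasDerivAt_tan h0).comp (0 : ℝ) ((hasDerivAt_id (0 : ℝ)).div_const 2)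
  simp only [Function.comp_def, id_eq, zero_div, cos_zero, one_pow, div_one, one_mul] at h
  exact h

/-- `s'(0) = −1`. [folklore] -/
theorem hasDerivAt_neg_sin_zero : HasDerivAt (fun θ : ℝ => -sin θ) (-1) 0 := by
  have h := (hasDerivAt_sin (0 : ℝ)).neg
  rw [cos_zero] at h
  exact h

/-- the combination entering the vacuum zero-point derivative: `s'(0) − 2 t'(0) = −2`. [folklore] -/
theorem neg_one_sub_two_mul_half : (-1 : ℝ) - 2 * (1 / 2) = -2 := by norm_num

/-- mirror data: `t = −tan(·/2)` has `t'(0) = −1/2`. [folklore] -/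
theorem hasDerivAt_neg_tan_half_zero : HasDerivAt (fun θ : ℝ => -tan (θ / 2)) (-(1 / 2)) 0 :=
  hasDerivAt_tan_half_zero.neg

/-- mirror data: `s = sin` has `s'(0) = 1`. [folklore] -/
theorem hasDerivAt_sin_zero' : HasDerivAt (fun θ : ℝ => sin θ) 1 0 := by
  have h := hasDerivAt_sin (0 : ℝ)
  rw [cos_zero] at h
  exact h

/-- mirror data: `t(0) = 0`. [folklore] -/
theorem neg_tan_half_zero : -tan ((0 : ℝ) / 2) = 0 := by simp

/-- mirror combination: `s'(0) − 2 t'(0) = 2`. [folklore] -/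
theorem one_sub_two_mul_neg_half : (1 : ℝ) - 2 * (-(1 / 2)) = 2 := by norm_num

end Literature.LinearAlgebra.Matrix.RotationThreeShears

end
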